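import Mathlib
import HarnessLib
import Summits.Langlands.Langlands.Theses.QuarterDeficit1951
import Summits.Langlands.Langlands.Theorems.ParityBlindBianchiArtinWeightRealisationLevelSolvableSector
import Literature.NumberTheory.Automorphic.StrongArtinCentralCharacter
import Literature.NumberTheory.Automorphic.AutomorphicRepsGL2WeightOneCleanModel
import Literature.NumberTheory.Automorphic.NewformAdelisationHeckeOperator
import Literature.NumberTheory.Automorphic.CertifiedMaassHeckeTraceCensus
import Literature.NumberTheory.Automorphic.HyperbolicLaplaceSpectrum
import Summits.Langlands.Langlands.Theorems.QuarterDeficit1951CorrespondentFingerprintCompositionLemmas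
import Summits.Langlands.Langlands.Theorems.QuarterDeficit1951CorrespondentFingerprintStubBarrier
import Summits.Langlands.Langlands.Theorems.QuarterDeficit1951CorrespondentFingerprintStubArchParameter
import Summits.Langlands.Langlands.Theorems.QuarterDeficit1951CorrespondentFingerprintStubCentralCharacter
import Summits.Langlands.Langlands.Theorems.QuarterDeficit1951CorrespondentFingerprintStubSatakeSmallPrimes
import Summits.Langlands.Langlands.Theorems.QuarterDeficit1951CorrespondentFingerprintStubGlue
import Summits.Langlands.Langlands.Theorems.QuarterDeficit1951CorrespondentFingerprintStubLevelOneSpherical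
import Summits.Langlands.Langlands.Theorems.QuarterDeficit1951CorrespondentFingerprintStubLevelOneAssembly

/-!
# The crux `QuarterDeficit1951.CorrespondentFingerprint` (stmt-Langlands-15898) MODULO its two open
stubs — line `Sketch`, landed composition (registered sub-goal `stub_composition`)

`stub_composition : (local conductor-one statement at 1951) → (weight-0 descent) → CorrespondentFingerprint`.
Everything else the line needs is landed and imported: `stub_barrier` (p129075), `stub_archParameter`
(p128712), `stub_centralCharacter` (p128762), `stub_satakeSmallPrimes` (p128915), `stub_glue`
(p130032), `stub_levelOne_spherical` (p129624), `stub_levelOne_assembly` (p129825).  Proof: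
contragredient transport `τ = ι ∘ ρ^∨` puts the correspondent in Tunnell's `IsPiOfArtinRep` world
(`Corresponds.1`); the centre acts by `ψ_{χ₀}` (`det τ(Frob) = χ₀`), giving the even archimedean
sign (`χ₀(-1) = 1`); the archimedean parameter is `{a, -a}`; the `K₁(1951)`-vector comes from the
spherical/assembly theorems and the local hypothesis; the glue gives one clean vector; the descent
gives the Maass form of eigenvalue `1/4 - a²`; the barrier forces `a = 0`; Satake–Frobenius
compatibility at `p ≤ 13` from local–global compatibility and the Hecke dictionary give
`μ_p = α + β`, `χ₀(p) = αβ`, and the Frobenius data give `(α + β)²/(αβ) = ι(t)²/ι(d) ∈ Φ`.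
-/

set_option linter.dupNamespace false

noncomputable section

open scoped BigOperators Matrix NumberField MatrixGroups NNReal Polynomial ComplexConjugate Classical
open Literature.NumberTheory.Automorphic Literature.NumberTheory.GaloisRepresentations
  IsDedekindDomain NumberField Filter Polynomial
open Literature.NumberTheory.Automorphic.GL2Real
open Rat.HeightOneSpectrum
open Summit.Langlands

namespace Summit.Langlands.Langlands.Theorems.CorrespondentFingerprint

/-! ## Composition -/

/-- **Registered sub-goal `stub_composition`: the crux MODULO its two open stubs** — the local
conductor-one statement at `1951` (`stub_levelOne_local1951`, hypothesis `hloc`) and the weight-`0`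
descent (`stub_descent`, hypothesis `hdesc`) imply `CorrespondentFingerprint`; see the module
docstring for the proof line. [folklore] -/
theorem stub_composition : (∀ (RD : Summit.Langlands.ReciprocityData ℚ) (ℓ : ℕ) [Fact ℓ.Prime]
    (ι : PadicAlgCl ℓ ≃+* ℂ) (hcpt : isCompact_glFiniteIntegralLevel 2 ℚ)
    (π : CuspidalAutomorphicRepData 2 ℚ hcpt) (ρ : FramedGaloisRep ℚ (PadicAlgCl ℓ) 2),
    17 ≤ ℓ → ℓ ≠ 1951 →
    (ρ.toGaloisRep.IsIrreducible ∧ (Set.range ρ).Finite ∧ ρ.IsEven ∧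
      ρ.toGaloisRep.artinConductorNat = 1951 ∧
      ∃ χ₀ : DirichletCharacter ℂ 1951, orderOf χ₀ = 5 ∧
        ∀ v : HeightOneSpectrum (𝓞 ℚ), v.residueCard ≠ 1951 →
          ρ.IsUnramifiedAt v ∧ ∃ t d : PadicAlgCl ℓ,
            ρ.HasFrobCharpolyAt v (X ^ 2 - C t * X + C d) ∧
            ι d = (χ₀ (v.residueCard : ZMod 1951))⁻¹ ∧
            (t ^ 2 = 0 ∨ t ^ 2 = d ∨ t ^ 2 = 4 * d ∨ t ^ 4 - 3 * d * t ^ 2 + d ^ 2 = 0)) →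
    Summit.Langlands.Corresponds RD ι π.1 ρ →
    ∀ v : HeightOneSpectrum (𝓞 ℚ), v.residueCard = 1951 →
      ∃ (πv : SmoothIrrep (GL (Fin 2) (v.adicCompletion ℚ))) (x₀ : πv.V),
        π.1.HasLocalComponentAt v πv.ρ ∧ x₀ ≠ 0 ∧
          ∀ m : GL (Fin 2) (v.adicCompletion ℚ), IsLocK1 v (Ideal.span {(1951 : 𝓞 ℚ)}) m →
            πv.ρ m x₀ = x₀) →
    (∀ (hcpt : isCompact_glFiniteIntegralLevel 2 ℚ) (N : ℕ) [NeZero N]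
    (χ₁ : DirichletCharacter ℂ N) (c : ℝ) (φ₀ : (AdelicGroupData.gl 2 ℚ).Adelic → ℂ),
    φ₀ ∈ cuspFormsGL 2 ℚ hcpt → φ₀ ≠ 0 →
    (∀ u ∈ gammaOneFiniteLevel ℚ (Ideal.span {(N : 𝓞 ℚ)}),
      rightTranslation (AdelicGroupData.gl 2 ℚ)
          (show (AdelicGroupData.gl 2 ℚ).Adelic from GLn.ofFinite 2 ℚ u) φ₀ = φ₀) →
    (∀ z : ideleGroup ℚ,
      rightTranslation (AdelicGroupData.gl 2 ℚ) (Matrix.GeneralLinearGroup.scalar (Fin 2) z) φ₀ =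
        ((HeckeCharacter.ofDirichlet χ₁ z : ℂˣ) : ℂ) • φ₀) →
    (∀ z ∈ (AdelicGroupData.gl 2 ℚ).center', ∀ g, φ₀ (z * g) = φ₀ g) →
    IsArchSmooth Rat.iotaA φ₀ → IsWeightVec Rat.iotaA 0 φ₀ → lieDeriv Rat.iotaA (toLie 1) φ₀ = 0 →
    casimirFun Rat.iotaA φ₀ = (c : ℂ) • φ₀ →
    let u : UpperHalfPlane → ℂ := fun τ => φ₀ (Rat.ofRealGLA (upperHalfPlaneToGL τ))
    IsMaassCuspFormOn N χ₁ u (-c / 2) ∧ (∃ z, u z ≠ 0) ∧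
      ∀ v : HeightOneSpectrum (𝓞 ℚ), ¬ v.asIdeal ∣ Ideal.span {(N : 𝓞 ℚ)} → ∀ c₁ c₂ : ℂ,
        heckeOperator (rightTranslation (AdelicGroupData.gl 2 ℚ))
            (show Subgroup (AdelicGroupData.gl 2 ℚ).Adelic from
              principalCongruenceLevel 2 ℚ (Ideal.span {(N : 𝓞 ℚ)}))
            (heckeDiagAt 2 ℚ v (Rat.localUniformizer v) 1) φ₀ = c₁ • φ₀ →
        heckeOperator (rightTranslation (AdelicGroupData.gl 2 ℚ))
            (show Subgroup (AdelicGroupData.gl 2 ℚ).Adelic from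
              principalCongruenceLevel 2 ℚ (Ideal.span {(N : 𝓞 ℚ)}))
            (heckeDiagAt 2 ℚ v (Rat.localUniformizer v) 2) φ₀ = c₂ • φ₀ →
        (∀ z, maassHeckeOp N χ₁ (natGenerator v) u z =
            (c₁ / (((Real.sqrt (natGenerator v : ℝ)) : ℝ) : ℂ)) * u z) ∧
          c₂ = χ₁ ((natGenerator v : ℕ) : ZMod N)) →
    Summit.Langlands.Langlands.Theses.QuarterDeficit1951.CorrespondentFingerprint := by
  intro hloc hdesc
  unfold Summit.Langlands.Langlands.Theses.QuarterDeficit1951.CorrespondentFingerprint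
  dsimp only
  intro RD ℓ _ ι hcpt π ρ hℓ hℓ1951 hρ hLalg hcorr
  obtain ⟨hirr, hfin, hevenρ, hcond, χ₀, hχ₀, hfrob⟩ := hρ
  haveI : NeZero (1951 : ℕ) := ⟨by norm_num⟩
  -- (0) contragredient transport `τ = ι ∘ ρ^∨`, `IsPiOfArtinRep τ π`
  have hfinR : Finite ρ.toMonoidHom.range := by
    have e : ((ρ.toMonoidHom.range : Subgroup (GL (Fin 2) (PadicAlgCl ℓ))) :
        Set (GL (Fin 2) (PadicAlgCl ℓ))) = Set.range ρ := by
      rw [MonoidHom.coe_range]; rfl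
    exact Set.finite_coe_iff.mpr (e ▸ hfin)
  obtain ⟨τ, hτ⟩ := ArtinWeightRealisationLevel.exists_dual_transport ι ρ hfinR
  have hπτ : IsPiOfArtinRep τ π.1 := hcorr.1.mono fun v hv =>
    (ArtinWeightRealisationLevel.satakeFrobCompatibleAt_iff_of_dual_transport ι ρ τ hτ π.1 v).1 hv
  -- (1) `det τ(Frob_v) = χ₀(q_v)` at the good places
  have hdet : ∀ v : HeightOneSpectrum (𝓞 ℚ), τ.IsUnramifiedAt v → ¬ natGenerator v ∣ 1951 →
      ∀ 𝔓 ∈ v.primesAbove, ∀ Φ : Field.absoluteGaloisGroup ℚ, IsArithFrobAt (𝓞 ℚ) Φ 𝔓 →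
        ((FramedRep.det τ Φ : ℂˣ) : ℂ) = χ₀ ((v.residueCard : ℕ) : ZMod 1951) := by
    intro v _ hvN 𝔓 h𝔓 Φ hΦ
    have hq : v.residueCard ≠ 1951 := by
      intro h
      apply hvN
      rw [← Rat.residueCard_eq_natGenerator, h]
    obtain ⟨-, t, d, hP, hιd, -⟩ := hfrob v hq
    rw [det_dual_transport_eq_inv ι ρ τ hτ hP h𝔓 hΦ, hιd, inv_inv]
  -- (2) the centre acts by `ψ_{χ₀}`
  have hcen := stub_centralCharacter hcpt π.1 τ 1951 χ₀ hπτ hdet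
  -- (3) the even sign: `-1_∞` acts trivially (`χ₀(-1) = 1`)
  have hχneg : χ₀ (-1) = 1 := dirichletCharacter_neg_one_of_orderOf_eq_five χ₀ hχ₀
  have heven : ∀ φ ∈ π.1.W, rightTranslation (AdelicGroupData.gl 2 ℚ)
      ((AutomorphyDatum.gl 2 ℚ hcpt).ofArch ⟨-1, trivial⟩) φ - φ ∈ π.1.W' := by
    intro φ hφ
    have key := hcen (Rat.infIdele (-1)) φ hφ
    rw [HeckeCharacter.ofDirichlet_infIdele_neg_one, hχneg, one_smul] at key
    rw [ofArch_neg_one_eq_scalar_infIdele]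
    exact key
  -- (4) the archimedean parameter `{a, -a}`
  obtain ⟨a, harch⟩ := stub_archParameter hcpt π.1 τ hπτ hLalg
  -- (5) the `K₁(1951)`-vector, the glue, the descent
  have hfix := stub_levelOne_assembly hcpt π
    (fun v hv => stub_levelOne_spherical ℚ ℓ hcpt RD ι π ρ v (hfrob v hv).1 (hcorr.2 v))
    (hloc RD ℓ ι hcpt π ρ hℓ hℓ1951 ⟨hirr, hfin, hevenρ, hcond, χ₀, hχ₀, hfrob⟩ hcorr)
  obtain ⟨φ₀, hcuspφ, hφ0, hK1, hcenφ, hAG, hsm, hw0, hZ, hcas, hhecke⟩ :=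
    stub_glue hcpt π 1951 χ₀ a hcen heven harch hfix
  obtain ⟨hM, hu0, hTp⟩ := hdesc hcpt 1951 χ₀ (2 * (a : ℝ) ^ 2 - 1 / 2) φ₀ hcuspφ hφ0 hK1
    hcenφ hAG hsm hw0 hZ hcas
  set u : UpperHalfPlane → ℂ := fun z => φ₀ (Rat.ofRealGLA (upperHalfPlaneToGL z)) with hu_def
  -- (6) `u` is `1`-periodic (`T ∈ Γ₀(1951)`)
  have hT : ModularGroup.T ∈ CongruenceSubgroup.Gamma0 1951 := by
    rw [CongruenceSubgroup.Gamma0_mem, ModularGroup.coe_T]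
    simp
  have hper : ∀ z : UpperHalfPlane, u ((1 : ℝ) +ᵥ z) = u z := by
    intro z
    have h := hM.slash ModularGroup.T hT z
    rw [UpperHalfPlane.modular_T_smul, ModularGroup.coe_T] at h
    rw [h]
    simp
  -- (7) the barrier forces `a = 0`
  have ha0 : a = 0 := by
    by_contra ha
    obtain ⟨z₀, hz₀⟩ := hu0
    apply hz₀
    refine stub_barrier u ((a : ℝ) ^ 2 - 1 / 4) ?_ hM.isC2 ?_ hper hM.bounded z₀
    · have h1 : (1 : ℤ) ≤ a ^ 2 := by
        have := Int.one_le_abs ha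
        nlinarith [abs_nonneg a, sq_abs a]
      have h1' : (1 : ℝ) ≤ (a : ℝ) ^ 2 := by exact_mod_cast h1
      linarith
    · intro z
      have h := hM.eigen z
      push_cast at h ⊢
      linear_combination h
  subst ha0
  have e4 : (-(2 * ((0 : ℤ) : ℝ) ^ 2 - 1 / 2) / 2 : ℝ) = 1 / 4 := by norm_num
  rw [e4] at hM
  -- (8) continuity of `u` along horizontal lines (for the period integral)
  have hcont : ∀ y : ℝ, 0 < y →
      Continuous (fun x : ℝ => u (UpperHalfPlane.ofComplex ((x : ℂ) + y * Complex.I))) := by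
    intro y hy
    have h := hM.isC2.continuousOn.comp_continuous
      (f := fun x : ℝ => ((x : ℂ) + y * Complex.I)) (by fun_prop) (fun x => by simp [hy])
    exact h
  have hperx : ∀ y : ℝ, 0 < y →
      Function.Periodic (fun x : ℝ => u (UpperHalfPlane.ofComplex ((x : ℂ) + y * Complex.I))) 1 := by
    intro y hy x
    have him : 0 < ((x : ℂ) + y * Complex.I).im := by simp [hy]
    have him' : 0 < (((x + 1 : ℝ) : ℂ) + y * Complex.I).im := by simp [hy]
    have e : UpperHalfPlane.ofComplex (((x + 1 : ℝ) : ℂ) + y * Complex.I) =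
        (1 : ℝ) +ᵥ UpperHalfPlane.ofComplex ((x : ℂ) + y * Complex.I) := by
      apply UpperHalfPlane.ext
      rw [UpperHalfPlane.ofComplex_apply_of_im_pos him', UpperHalfPlane.coe_vadd,
        UpperHalfPlane.ofComplex_apply_of_im_pos him]
      push_cast
      ring
    simp only
    rw [e, hper]
  -- (9) the Hecke eigenvalues and the fingerprint at a good prime `p < 17`
  have key : ∀ p : ℕ, p.Prime → p ≠ 1951 → p < 17 →
      ∃ μ φ : ℂ, φ ∈ ({0, 1, 4, (((3 + Real.sqrt 5) / 2 : ℝ) : ℂ), (((3 - Real.sqrt 5) / 2 : ℝ) : ℂ)} : Set ℂ) ∧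
        (∀ z : UpperHalfPlane, ((Real.sqrt p : ℝ) : ℂ)⁻¹ *
            ((∑ b ∈ Finset.range p, u (UpperHalfPlane.ofComplex (((z : ℂ) + b) / p))) +
              χ₀ (p : ZMod 1951) * u (UpperHalfPlane.ofComplex ((p : ℂ) * z))) = μ * u z) ∧
        μ ^ 2 * (starRingEnd ℂ) (χ₀ (p : ZMod 1951)) = φ := by
    intro p hp hp1951 hp17
    set v : HeightOneSpectrum (𝓞 ℚ) := (primesEquiv (R := 𝓞 ℚ)).symm ⟨p, hp⟩ with hv_def
    have hv : natGenerator v = p := congrArg Subtype.val ((primesEquiv (R := 𝓞 ℚ)).apply_symm_apply ⟨p, hp⟩)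
    have hq : v.residueCard = p := by rw [Rat.residueCard_eq_natGenerator, hv]
    have hvN : ¬ v.asIdeal ∣ Ideal.span {((1951 : ℕ) : 𝓞 ℚ)} := by
      rw [← Rat.natGenerator_dvd_iff, hv]
      intro hdvd
      have h1951 : Nat.Prime 1951 := by norm_num
      rcases (Nat.dvd_prime h1951).mp hdvd with h | h
      · exact hp.one_lt.ne' h
      · exact hp1951 h
    have hvℓ : ((ℓ : ℕ) : 𝓞 ℚ) ∉ v.asIdeal := by
      rw [Rat.natCast_mem_asIdeal_iff, hv]
      intro hdvd
      rcases (Nat.dvd_prime Fact.out).mp hdvd with h | h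
      · exact hp.one_lt.ne' h
      · omega
    obtain ⟨hunr, t, d, hP, hιd, hdisj⟩ := hfrob v (by rw [hq]; exact_mod_cast hp1951)
    -- Satake–Frobenius compatibility at `v` from local–global compatibility
    obtain ⟨α, hα, -, hαP⟩ := stub_satakeSmallPrimes RD ℓ ι hcpt π ρ v hfin hvℓ hunr (hcorr.2 v)
    obtain ⟨α₁, α₂, rfl⟩ := Multiset.card_eq_two.mp hα.card_eq
    -- compare the two Frobenius polynomials
    obtain ⟨𝔓, h𝔓⟩ := v.primesAbove_nonempty
    obtain ⟨Φ, hΦ⟩ := HeightOneSpectrum.exists_isArithFrobAt_of_mem_primesAbove_holds h𝔓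
    have hpoly : X ^ 2 - C t * X + C d =
        X ^ 2 - C (ι.symm α₁⁻¹ + ι.symm α₂⁻¹) * X + C (ι.symm α₁⁻¹ * ι.symm α₂⁻¹) := by
      rw [← hP 𝔓 h𝔓 Φ hΦ, hαP 𝔓 h𝔓 Φ hΦ, arithFrobPolyOfSatake_one, Multiset.insert_eq_cons,
        Multiset.map_cons, Multiset.map_singleton, Multiset.prod_cons, Multiset.prod_singleton]
      simp only [C_add, C_mul]
      ring
    have ht : t = ι.symm α₁⁻¹ + ι.symm α₂⁻¹ := by
      have h := congrArg (fun P : (PadicAlgCl ℓ)[X] => P.coeff 1) hpoly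
      simp only [coeff_add, coeff_sub, coeff_X_pow, coeff_C_mul, coeff_X_one, coeff_C,
        if_neg (by norm_num : (1 : ℕ) ≠ 2), if_neg (one_ne_zero)] at h
      linear_combination -h
    have hd : d = ι.symm α₁⁻¹ * ι.symm α₂⁻¹ := by
      have h := congrArg (fun P : (PadicAlgCl ℓ)[X] => P.coeff 0) hpoly
      simp only [coeff_add, coeff_sub, coeff_X_pow, coeff_C_mul, coeff_X_zero, coeff_C_zero,
        if_neg (by norm_num : (0 : ℕ) ≠ 2), mul_zero, sub_zero, zero_add] at h
      exact h
    have hιt : ι t = α₁⁻¹ + α₂⁻¹ := by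
      rw [ht, map_add, RingEquiv.apply_symm_apply, RingEquiv.apply_symm_apply]
    have hιd' : ι d = α₁⁻¹ * α₂⁻¹ := by
      rw [hd, map_mul, RingEquiv.apply_symm_apply, RingEquiv.apply_symm_apply]
    -- `χ₀(p) ≠ 0`, so `ι d ≠ 0` and `α₁, α₂ ≠ 0`
    have hcop : Nat.Coprime p 1951 := by
      rw [Nat.coprime_comm, Nat.Prime.coprime_iff_not_dvd (by norm_num : Nat.Prime 1951)]
      intro h
      rcases (Nat.dvd_prime hp).mp h with h' | h'
      · norm_num at h'
      · exact hp1951 h'.symm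
    have hχp : χ₀ (p : ZMod 1951) ≠ 0 := by
      rw [← ZMod.coe_unitOfCoprime p hcop]
      exact (χ₀.toUnitHom (ZMod.unitOfCoprime p hcop)).ne_zero ∘ (by
        intro h; rw [← MulChar.coe_toUnitHom] at h; exact h)
    have hD : ι d ≠ 0 := by
      rw [hιd, hq]
      exact inv_ne_zero (by exact_mod_cast hχp)
    have hα₁ : α₁ ≠ 0 := by
      intro h; apply hD; rw [hιd', h, inv_zero, zero_mul]
    have hα₂ : α₂ ≠ 0 := by
      intro h; apply hD; rw [hιd', h, inv_zero, mul_zero]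
    -- the Hecke dictionary: `T_p u = (α₁ + α₂) u`, `χ₀(p) = α₁ α₂`
    obtain ⟨h1, h2⟩ := hhecke v (by exact_mod_cast hvN) _ hα
    obtain ⟨hTpz, hc₂⟩ := hTp v (by exact_mod_cast hvN) _ _ h1 h2
    rw [Multiset.insert_eq_cons, Multiset.esymm_pair_two] at hc₂
    have hsqrt : ((Real.sqrt p : ℝ) : ℂ) ≠ 0 := by
      exact_mod_cast (Real.sqrt_pos.mpr (by exact_mod_cast hp.pos)).ne'
    refine ⟨α₁ + α₂, (α₁ + α₂) ^ 2 * (starRingEnd ℂ) (χ₀ (p : ZMod 1951)), ?_, ?_, rfl⟩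
    · -- the fingerprint: `(α₁ + α₂)² conj(χ₀ p) = (ι t)² / ι d ∈ Φ`
      have hnorm : ‖χ₀ (p : ZMod 1951)‖ = 1 := by
        rw [← ZMod.coe_unitOfCoprime p hcop]
        exact χ₀.unit_norm_eq_one (ZMod.unitOfCoprime p hcop)
      have hconj : (starRingEnd ℂ) (χ₀ (p : ZMod 1951)) = (χ₀ (p : ZMod 1951))⁻¹ :=
        (Complex.inv_eq_conj hnorm).symm
      have hχαβ : χ₀ (p : ZMod 1951) = α₁ * α₂ := by
        rw [hv] at hc₂
        exact hc₂.symm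
      have hval : (α₁ + α₂) ^ 2 * (starRingEnd ℂ) (χ₀ (p : ZMod 1951)) = (ι t) ^ 2 / ι d := by
        rw [hconj, hχαβ, hιt, hιd']
        field_simp
        ring
      rw [hval]
      refine sq_div_mem_fingerprint hD ?_
      rcases hdisj with h | h | h | h
      · left; rw [← map_pow, h, map_zero]
      · right; left; rw [← map_pow, h]
      · right; right; left
        rw [← map_pow, h, map_mul, map_ofNat]
      · right; right; right
        have := congrArg ι h
        rw [map_zero] at this
        rw [← this]
        simp only [map_add, map_sub, map_mul, map_pow, map_ofNat]
    · intro z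
      have h := hTpz z
      rw [hv, maassHeckeOp_prime 1951 χ₀ hp u z, Multiset.insert_eq_cons, Multiset.esymm_pair_one,
        hq] at h
      rw [h]
      congr 1
      field_simp
  -- (10) assemble the conclusion
  refine ⟨χ₀, hχ₀, u, ⟨hM.isC2, hM.eigen, hM.slash, ?_, ?_, hM.bounded⟩, hu0, ?_⟩
  · -- cusp `∞` (width `1`) from the period-`1951` mean and `1`-periodicity
    intro y hy
    have h := hM.cuspidal 1 y hy
    simp only [one_smul] at h
    rw [intervalIntegral_zero_nat_of_periodic (hperx y hy) (hcont y hy) 1951] at h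
    exact (mul_eq_zero.mp h).resolve_left (by norm_num)
  · -- cusp `0` (width `1951`)
    intro y hy
    have h := hM.cuspidal ModularGroup.S y hy
    exact_mod_cast h
  · intro p hp
    simp only [Finset.mem_insert, Finset.mem_singleton] at hp
    rcases hp with rfl | rfl | rfl | rfl | rfl | rfl <;>
      exact key _ (by norm_num) (by norm_num) (by norm_num)

end Summit.Langlands.Langlands.Theorems.CorrespondentFingerprint

end
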